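import Literature.AnabelianGeometry.EtaleTheta.ThetaCoversProp22iSignToy
import Literature.AnabelianGeometry.EtaleTheta.Discharge.Sec2InversionProofs

/-!
# Independence of the two `ι`-eigenvalue axioms for [EtTh] Prop 2.2 (i) at the typed interface
# (kernel countermodels in the abelian sign toys `(ℤ/l)³ ⋊ ℤˣ`; toy ≠ print)

Mochizuki, *The Étale Theta Function …* [EtTh], Publ. RIMS 45 (2009), §2, Prop 2.2 (i), PRIMS text p.37
(bib key `MochizukiEtTh2009`): "Suppose that `l` is odd. (i) The conjugation action of `ι̲` on the rank
two `(ℤ/lℤ)`-module `Δ̄_X̲` determines a direct product decomposition `Δ̄_X̲ ≅ Δ̄^ell_X̲ × Δ̄_Θ` into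
eigenspaces, with eigenvalues `−1` and `1`, respectively, that is compatible with the conjugation action
of `Π_X̲`."  Kernel facts about the TYPED interface `ThetaCovers.CoverData l` (`ThetaCovers.lean`) and
its supplement `CoverDataAx l` (`ThetaCoversAxioms.lean`; both seat abc-iut-L2-t2, nothing there edited
or restated; `CoverDataAx.prop22_i_holds` of `Discharge/Sec2InversionProofs.lean`, abc-iut-L2-t10, is
consumed BY NAME), over the sign toys `SignToy.signToy l se sθ hl` of `ThetaCoversProp22iSignToy.lean`:
* `pow_mem_barKer` holds in all four toys (`signToy_pow_mem`); `inv_ell` ("`Δ_C ∖ Δ_X` acts by `−1` on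
  `Δ̄^ell_X`") holds iff `se` (`signToy_inv_ell_iff`); `inv_theta` ("… by `+1` on `Δ̄_Θ`") holds iff
  `¬ sθ` (`signToy_inv_theta_iff`) — odd `l ≥ 3`;
* **`signToy_prop22_i_iff`**: `(signToy l se sθ hl).Prop22_i ↔ (se ∧ ¬ sθ)` (odd `l ≥ 3`): at the
  explicit `Π_C̲ := {b = 0} ⋊ ℤˣ` (type `(1, l-tors)±`) with inversion `ι̲ := (0, −1)`, if `sθ` the clause
  "`ι̲` acts by `+1` on `Δ̄_Θ`" of `IsMinusEigen` fails for EVERY candidate `E`; if `¬ se` the clause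
  "`ι̲` acts by `−1` on `E`" forces `E = 1`, contradicting `E · Δ̄_Θ = Δ_X̲`; conversely at `(true, false)`
  the toy is a `CoverDataAx` (`signToyAx`) and `CoverDataAx.prop22_i_holds` applies;
* corollaries: **`CoverData.exists_inv_ell_not_prop22_i`** — `inv_theta` is NECESSARY for Prop 2.2 (i)
  at the interface EVEN GIVEN `inv_ell` and `pow_mem_barKer` (the toy `(−, −)`: `ι̲` inverts everything;
  NEW w.r.t. the state of record); **`CoverData.exists_inv_theta_not_prop22_i`** — `inv_ell` is necessary
  given `inv_theta` and `pow_mem_barKer` (the toy `(+, +)`, `ι̲` central); so neither binder `hιell` /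
  `hιtheta` of the L2 discharge (GAP-LEDGER G-L2t10-4) is idle; **`CoverData.not_forall_prop22_i_of_odd`**
  — for EVERY odd `l ≥ 3` the universal closure `∀ X : CoverData l, X.Prop22_i` is refuted.
STATE OF RECORD (acknowledged, not restated): abc-iut-w6-d083's `Discharge/Sec2Prop22iRmk211BareNegative.lean`
(p434578) already refutes the closures `∀ l X, X.Prop22_i` / `X.Rmk211` (FACT-LIST F-0596 / F-0599) at ONE
abelian toy (`l = 3`, `ι` central — the `(+, +)` phenomenon); this file is the complementary half
(`inv_theta` independent of `inv_ell`), the all-odd-`l` family, and the exact sign-pattern criterion.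

HONEST SCOPE. Toy independence at the typed interface only; consistency/independence ≠ faithfulness. In
print `ι` IS the elliptic inversion, `−1` on `Δ^ell_X = Δ_X^ab`, and `Δ_Θ = [Δ_X, Δ_X]`, so `+1` on `Δ_Θ`
FOLLOWS (`ThetaSetting.PiCData.inv_theta_of_inv_ell`, `Discharge/Sec2Prop22InvThetaOfInvEll.lean`); in
the abelian toys `[Δ_X, Δ_X] = 1 ≠ Δ̄_Θ` — exactly the room the bare interface leaves. Nothing here takes a
side on anything printed. abc-iut cell, seat abc-iut-w6-d081 (W6 row EtTh:Prop2.2(i)).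
[cite: MochizukiEtTh2009, Prop 2.2(i) p.37]
-/

namespace Literature.AnabelianGeometry.EtaleTheta

namespace ThetaCovers

namespace SignToy

open Multiplicative

variable {l : ℕ} {se sθ : Bool}

/-! ## 5. Powers and the supplementary axiom `pow_mem_barKer` -/

/-- Coordinates of powers inside `Π_X = (ℤ/l)³ ⋊ 1`. (toy; no claim about print) [cite: MochizukiEtTh2009, Def 2.1 p.36] -/
theorem coords_pow (d : G l se sθ) (hd : d.right = 1) (n : ℕ) :
    ca (d ^ n) = n * ca d ∧ cb (d ^ n) = n * cb d ∧ cc (d ^ n) = n * cc d ∧ (d ^ n).right = 1 := by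
  induction n with
  | zero => simp
  | succ n ih =>
    obtain ⟨h1, h2, h3, h4⟩ := ih
    refine ⟨?_, ?_, ?_, ?_⟩
    · rw [pow_succ, ca_mul, h1, h4, sgn_one, one_mul, Nat.cast_succ]; ring
    · rw [pow_succ, cb_mul, h2, h4, sgn_one, one_mul, Nat.cast_succ]; ring
    · rw [pow_succ, cc_mul, h3, h4, sgn_one, one_mul, Nat.cast_succ]; ring
    · rw [pow_succ, SemidirectProduct.mul_right, h4, hd, one_mul]

/-- For `l` odd, `a + a = 0` forces `a = 0` in `ℤ/l`. (toy; no claim about print) [cite: MochizukiEtTh2009, Prop 2.2(i) p.37] -/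
theorem eq_zero_of_add_self (hl : Odd l) {a : ZMod l} (h : a + a = 0) : a = 0 := by
  have h2 : IsUnit (2 : ZMod l) := by
    have := (ZMod.isUnit_iff_coprime 2 l).mpr (Nat.coprime_two_left.mpr hl)
    exact_mod_cast this
  rw [← two_mul] at h
  exact (h2.mul_right_eq_zero).mp h

/-- For `l` odd and `l ≠ 1`, `2 ≠ 0` in `ℤ/l`. (toy; no claim about print) [cite: MochizukiEtTh2009, Prop 2.2(i) p.37] -/
theorem two_ne_zero_zmod (hl : Odd l) (h1 : 1 < l) : (2 : ZMod l) ≠ 0 := by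
  haveI : Fact (1 < l) := ⟨h1⟩
  intro h
  exact one_ne_zero (eq_zero_of_add_self hl (a := (1 : ZMod l)) (by rw [← two_mul, mul_one, h]))

variable (l se sθ) (hl : Odd l)

/-- `Δ̄_X` has exponent `l` in every sign toy: the `CoverDataAx` axiom `pow_mem_barKer` holds for all
four sign patterns. (toy; no claim about print) [cite: MochizukiEtTh2009, Prop 2.2(i) p.37] -/
theorem signToy_pow_mem :
    ∀ d ∈ (signToy l se sθ hl).PiX ⊓ (signToy l se sθ hl).aug.ker, d ^ l ∈ (signToy l se sθ hl).barKer := by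
  intro d hd
  have hd1 : d.right = 1 := hd.1
  obtain ⟨h1, h2, h3, h4⟩ := coords_pow d hd1 l
  show d ^ l = 1
  refine ext_coords ?_ ?_ ?_ ?_
  · rw [h1, ZMod.natCast_self, zero_mul, ca_one]
  · rw [h2, ZMod.natCast_self, zero_mul, cb_one]
  · rw [h3, ZMod.natCast_self, zero_mul, cc_one]
  · rw [h4, SemidirectProduct.one_right]

/-! ## 6. The `ι`-eigenvalue axioms `inv_ell`, `inv_theta` in the toys -/

/-- If `se`, an element of `Δ_C ∖ Δ_X` acts by `−1` on `Δ̄^ell_X`: the `CoverDataAx` axiom `inv_ell` HOLDS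
in the sign toy. (toy; no claim about print) [cite: MochizukiEtTh2009, Rmk 2.1.1 p.36] -/
theorem signToy_inv_ell (hse : se = true) :
    ∀ c ∈ (signToy l se sθ hl).aug.ker, c ∉ (signToy l se sθ hl).PiX →
      ∀ d ∈ (signToy l se sθ hl).PiX ⊓ (signToy l se sθ hl).aug.ker,
        c * d * c⁻¹ * d ∈ (signToy l se sθ hl).barTheta := by
  intro c _ hc d hd
  have hc' : c.right = -1 := (Int.units_eq_one_or c.right).resolve_left hc
  have hd1 : d.right = 1 := hd.1
  obtain ⟨e1, e2, -, e4⟩ := conj_coords c d hd1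
  subst hse
  refine ⟨?_, ?_, ?_⟩
  · rw [SemidirectProduct.mul_right, e4, hd1, one_mul]
  · rw [ca_mul, e1, e4, hc', sgn_true_neg_one, sgn_one]; ring
  · rw [cb_mul, e2, e4, hc', sgn_true_neg_one, sgn_one]; ring

/-- The explicit inversion of the toys: `ι̲ := (0, −1) ∈ Δ_C ∖ Δ_X`. (toy) [cite: MochizukiEtTh2009, Prop 2.2 p.36] -/
def iota : G l se sθ := SemidirectProduct.inr (-1)

/-- `ι̲` has `ℤˣ`-component `−1`. (toy; no claim about print) [cite: MochizukiEtTh2009, Prop 2.2 p.36] -/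
@[simp] theorem iota_right : (iota l se sθ).right = -1 := rfl

/-- `ι̲ ∉ Π_X`. (toy; no claim about print) [cite: MochizukiEtTh2009, Prop 2.2 p.36] -/
theorem iota_not_mem_PiX : iota l se sθ ∉ PiX l se sθ := by
  intro h
  have h' : ((-1 : ℤˣ) : ℤ) = ((1 : ℤˣ) : ℤ) := congrArg Units.val h
  norm_num at h'

/-- If `¬ se` (and `l ≠ 1`), the axiom `inv_ell` FAILS in the sign toy: `ι̲` centralises the ell-coordinate
`a`, so `ι̲ d ι̲⁻¹ d` has `a`-coordinate `2 ≠ 0` at `d = (1, 0, 0)`. (toy; no claim about print)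
[cite: MochizukiEtTh2009, Rmk 2.1.1 p.36] -/
theorem signToy_not_inv_ell (hse : se = false) (h1 : 1 < l) :
    ¬ ∀ c ∈ (signToy l se sθ hl).aug.ker, c ∉ (signToy l se sθ hl).PiX →
      ∀ d ∈ (signToy l se sθ hl).PiX ⊓ (signToy l se sθ hl).aug.ker,
        c * d * c⁻¹ * d ∈ (signToy l se sθ hl).barTheta := by
  intro h
  subst hse
  set d : G l false sθ := SemidirectProduct.inl (ofAdd ((1 : ZMod l), (0 : ZMod l), (0 : ZMod l)))
    with hd
  have hdm : d ∈ (signToy l false sθ hl).PiX ⊓ (signToy l false sθ hl).aug.ker :=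
    ⟨rfl, mem_ker_one l false sθ d⟩
  have hmem := h (iota l false sθ) (mem_ker_one l false sθ _) (iota_not_mem_PiX l false sθ) d hdm
  have ha : ca (iota l false sθ * d * (iota l false sθ)⁻¹ * d) = 0 := hmem.2.1
  obtain ⟨e1, -, -, e4⟩ := conj_coords (iota l false sθ) d rfl
  have hca : ca d = 1 := rfl
  simp only [ca_mul, e1, e4, sgn_false, one_mul, hca] at ha
  exact two_ne_zero_zmod hl h1 (by linear_combination ha)

/-- If `¬ sθ`, an element of `Δ_C ∖ Δ_X` acts by `+1` on `Δ̄_Θ`: the `CoverDataAx` axiom `inv_theta` HOLDS in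
the sign toy. (toy; no claim about print) [cite: MochizukiEtTh2009, Prop 2.2(i) p.37] -/
theorem signToy_inv_theta (hsθ : sθ = false) :
    ∀ c ∈ (signToy l se sθ hl).aug.ker, c ∉ (signToy l se sθ hl).PiX →
      ∀ t ∈ (signToy l se sθ hl).barTheta, c * t * c⁻¹ * t⁻¹ ∈ (signToy l se sθ hl).barKer := by
  intro c _ _ t ht
  obtain ⟨ht1, ht2, ht3⟩ := ht
  obtain ⟨e1, e2, e3, e4⟩ := conj_coords c t ht1
  subst hsθ
  show c * t * c⁻¹ * t⁻¹ = 1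
  refine ext_coords ?_ ?_ ?_ ?_
  · simp only [ca_mul, ca_inv, e1, e4, ht2, mul_zero, neg_zero, add_zero, ca_one]
  · simp only [cb_mul, cb_inv, e2, e4, ht3, mul_zero, neg_zero, add_zero, cb_one]
  · simp only [cc_mul, cc_inv, e3, e4, ht1, sgn_false, one_mul, add_neg_cancel, cc_one]
  · simp only [SemidirectProduct.mul_right, SemidirectProduct.inv_right, e4, ht1, inv_one, mul_one,
      SemidirectProduct.one_right]

/-- The generator `t₀ := (0, 0, 1)` of `Δ̄_Θ` in the toys. (toy) [cite: MochizukiEtTh2009, Def 2.1 p.36] -/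
def tgen : G l se sθ := SemidirectProduct.inl (ofAdd ((0 : ZMod l), (0 : ZMod l), (1 : ZMod l)))

/-- `t₀ ∈ Δ̄_Θ`. (toy; no claim about print) [cite: MochizukiEtTh2009, Def 2.1 p.36] -/
theorem tgen_mem_Theta : tgen l se sθ ∈ Theta l se sθ := ⟨rfl, rfl, rfl⟩

include hl in
/-- If `sθ` (and `l ≠ 1`), `ι̲` acts by `−1` on `Δ̄_Θ`, so the commutator `ι̲ t₀ ι̲⁻¹ t₀⁻¹` has
`c`-coordinate `−2 ≠ 0`: it is NOT in `Ker = 1`. (toy; no claim about print)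
[cite: MochizukiEtTh2009, Prop 2.2(i) p.37] -/
theorem iota_tgen_comm_ne_one (hsθ : sθ = true) (h1 : 1 < l) :
    iota l se sθ * tgen l se sθ * (iota l se sθ)⁻¹ * (tgen l se sθ)⁻¹ ≠ 1 := by
  subst hsθ
  intro h
  have hc := congrArg cc h
  obtain ⟨-, -, e3, e4⟩ := conj_coords (iota l se true) (tgen l se true) rfl
  have hct : cc (tgen l se true) = 1 := rfl
  have htr : (tgen l se true).right = 1 := rfl
  simp only [cc_mul, cc_inv, e3, e4, iota_right, sgn_true_neg_one, sgn_one, htr, hct, cc_one, one_mul,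
    mul_one] at hc
  exact two_ne_zero_zmod hl h1 (by linear_combination -hc)

/-- If `sθ` (and `l ≠ 1`), the axiom `inv_theta` FAILS in the sign toy. (toy) [cite: MochizukiEtTh2009, Prop 2.2(i) p.37] -/
theorem signToy_not_inv_theta (hsθ : sθ = true) (h1 : 1 < l) :
    ¬ ∀ c ∈ (signToy l se sθ hl).aug.ker, c ∉ (signToy l se sθ hl).PiX →
      ∀ t ∈ (signToy l se sθ hl).barTheta, c * t * c⁻¹ * t⁻¹ ∈ (signToy l se sθ hl).barKer :=
  fun h => iota_tgen_comm_ne_one l se sθ hl hsθ h1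
    (h (iota l se sθ) (mem_ker_one l se sθ _) (iota_not_mem_PiX l se sθ) _ (tgen_mem_Theta l se sθ))

/-- **`inv_ell` in the sign toys ⟺ `se`** (odd `l ≥ 3`). (toy) [cite: MochizukiEtTh2009, Rmk 2.1.1 p.36] -/
theorem signToy_inv_ell_iff (h1 : 1 < l) :
    (∀ c ∈ (signToy l se sθ hl).aug.ker, c ∉ (signToy l se sθ hl).PiX →
      ∀ d ∈ (signToy l se sθ hl).PiX ⊓ (signToy l se sθ hl).aug.ker,
        c * d * c⁻¹ * d ∈ (signToy l se sθ hl).barTheta) ↔ se = true := by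
  cases se
  · exact iff_of_false (signToy_not_inv_ell l false sθ hl rfl h1) Bool.false_ne_true
  · exact iff_of_true (signToy_inv_ell l true sθ hl rfl) rfl

/-- **`inv_theta` in the sign toys ⟺ `¬ sθ`** (odd `l ≥ 3`). (toy) [cite: MochizukiEtTh2009, Prop 2.2(i) p.37] -/
theorem signToy_inv_theta_iff (h1 : 1 < l) :
    (∀ c ∈ (signToy l se sθ hl).aug.ker, c ∉ (signToy l se sθ hl).PiX →
      ∀ t ∈ (signToy l se sθ hl).barTheta, c * t * c⁻¹ * t⁻¹ ∈ (signToy l se sθ hl).barKer) ↔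
      sθ = false := by
  cases sθ
  · exact iff_of_true (signToy_inv_theta l se false hl rfl) rfl
  · exact iff_of_false (signToy_not_inv_theta l se true hl rfl h1) (by simp)

/-! ## 7. `Π_C̲ := {b = 0} ⋊ ℤˣ` is of type `(1, l-tors)±` and `ι̲` is an inversion -/

/-- **`Π_C̲` of the toys**: the elements with `b = 0`. (toy) [cite: MochizukiEtTh2009, Def 2.1 p.36] -/
def PiCu : Subgroup (G l se sθ) where
  carrier := {x | cb x = 0}
  mul_mem' := by
    intro x y hx hy
    simp only [Set.mem_setOf_eq] at hx hy ⊢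
    rw [cb_mul, hx, hy, mul_zero, add_zero]
  one_mem' := cb_one
  inv_mem' := by
    intro x hx
    simp only [Set.mem_setOf_eq] at hx ⊢
    rw [cb_inv, hx, mul_zero, neg_zero]

/-- Membership in `Π_C̲`. (toy; no claim about print) [cite: MochizukiEtTh2009, Def 2.1 p.36] -/
theorem mem_PiCu {x : G l se sθ} : x ∈ PiCu l se sθ ↔ cb x = 0 := Iff.rfl

/-- The `b`-coordinate character `Π_X ↠ ℤ/l` (the quotient `Q` of Def 2.1 in the toys; kernel `Π_X̲`).
(toy; no claim about print) [cite: MochizukiEtTh2009, Def 2.1 p.36] -/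
def bChar : ↥(PiX l se sθ) →* Multiplicative (ZMod l) where
  toFun x := ofAdd (cb x.1)
  map_one' := rfl
  map_mul' x y := by
    have hx : x.1.right = 1 := x.2
    apply toAdd.injective
    simp only [Subgroup.coe_mul, toAdd_ofAdd, toAdd_mul, cb_mul, hx, sgn_one, one_mul]

/-- `Π_X̲ := Π_C̲ ∩ Π_X` is of type `(1, l-tors)` in the toys. (toy) [cite: MochizukiEtTh2009, Def 2.1 p.36] -/
theorem isTypeLTors_PiCu : (signToy l se sθ hl).IsTypeLTors (PiCu l se sθ ⊓ PiX l se sθ) := by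
  refine ⟨inf_le_right, ⟨bChar l se sθ, ?_, ?_⟩, ?_, ?_, ?_⟩
  · intro y
    obtain ⟨b, rfl⟩ := Multiplicative.ofAdd.surjective y
    exact ⟨⟨SemidirectProduct.inl (ofAdd (0, b, 0)), rfl⟩, rfl⟩
  · intro g
    have hg : g.1.right = 1 := g.2
    constructor
    · intro h
      have h' := congrArg toAdd h
      simp only [bChar, MonoidHom.coe_mk, OneHom.coe_mk, toAdd_ofAdd, toAdd_one] at h'
      exact ⟨h', hg⟩
    · intro h
      apply toAdd.injective
      simp only [bChar, MonoidHom.coe_mk, OneHom.coe_mk, toAdd_ofAdd, toAdd_one]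
      exact h.1
  · intro x hx
    exact ⟨hx.2.2, hx.1⟩
  · refine le_antisymm (sup_le inf_le_right inf_le_left) fun x hx => ?_
    exact Subgroup.mem_sup_right ⟨hx, mem_ker_one l se sθ x⟩
  · intro x hx
    exact ⟨hx.2.2, hx.1⟩

/-- `[Π_C̲ : Π_X̲] = 2` in the toys. (toy; no claim about print) [cite: MochizukiEtTh2009, Def 2.1 p.36] -/
theorem relIndex_PiCu : (PiCu l se sθ ⊓ PiX l se sθ).relIndex (PiCu l se sθ) = 2 := by
  have hk : (PiCu l se sθ ⊓ PiX l se sθ).subgroupOf (PiCu l se sθ) =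
      ((SemidirectProduct.rightHom : G l se sθ →* ℤˣ).comp (PiCu l se sθ).subtype).ker := by
    ext x
    exact ⟨fun h => h.2, fun h => ⟨x.2, h⟩⟩
  have hs : Function.Surjective
      ((SemidirectProduct.rightHom : G l se sθ →* ℤˣ).comp (PiCu l se sθ).subtype) :=
    fun u => ⟨⟨SemidirectProduct.inr u, rfl⟩, rfl⟩
  rw [Subgroup.relIndex, hk, Subgroup.index_ker, MonoidHom.range_eq_top.mpr hs, Subgroup.card_top,
    Nat.card_eq_fintype_card, Fintype.card_units_int]

/-- `Π_C̲` is of type `(1, l-tors)±` in the toys. (toy) [cite: MochizukiEtTh2009, Def 2.1 p.36] -/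
theorem isTypeLTorsPm_PiCu : (signToy l se sθ hl).IsTypeLTorsPm (PiCu l se sθ) :=
  ⟨isTypeLTors_PiCu l se sθ hl, relIndex_PiCu l se sθ⟩

/-- `ι̲ = (0, −1)` is an inversion for `Π_C̲` in the toys. (toy) [cite: MochizukiEtTh2009, Prop 2.2 p.36] -/
theorem isInversion_iota : (signToy l se sθ hl).IsInversion (PiCu l se sθ) (iota l se sθ) :=
  ⟨rfl, mem_ker_one l se sθ _, iota_not_mem_PiX l se sθ⟩

/-! ## 8. Prop 2.2 (i) in the toys: `Prop22_i ⟺ (se ∧ ¬ sθ)` -/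

/-- If `sθ` (and `l ≠ 1`), NO `(−1)`-eigenspace datum `E` exists for `(Π_C̲, ι̲)`: the clause "`ι̲` acts by
`+1` on `Δ̄_Θ`" of `IsMinusEigen` fails at `t₀`, whatever `E` and `Π_X̲` are. (toy; no claim about print)
[cite: MochizukiEtTh2009, Prop 2.2(i) p.37] -/
theorem not_isMinusEigen_of_theta (hsθ : sθ = true) (h1 : 1 < l) (H E : Subgroup (G l se sθ)) :
    ¬ (signToy l se sθ hl).IsMinusEigen H (PiCu l se sθ) (iota l se sθ) E :=
  fun hE => iota_tgen_comm_ne_one l se sθ hl hsθ h1 (hE.plus _ (tgen_mem_Theta l se sθ))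

/-- If `¬ se` and `¬ sθ` (and `l ≠ 1`), NO `(−1)`-eigenspace datum `E` exists for `(Π_X̲, Π_C̲, ι̲)`: "`ι̲` acts
by `−1` on `E`" forces `E = 1` (`ι̲` is central on `Π_X`), and then `E · Δ̄_Θ = Δ̄_Θ ≠ Δ_X̲`.
(toy; no claim about print) [cite: MochizukiEtTh2009, Prop 2.2(i) p.37] -/
theorem not_isMinusEigen_of_not_ell (hse : se = false) (hsθ : sθ = false) (h1 : 1 < l)
    (E : Subgroup (G l se sθ)) :
    ¬ (signToy l se sθ hl).IsMinusEigen (PiCu l se sθ ⊓ PiX l se sθ) (PiCu l se sθ) (iota l se sθ) E := by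
  subst hse hsθ
  intro hE
  haveI : Fact (1 < l) := ⟨h1⟩
  have hE1 : E = ⊥ := by
    rw [eq_bot_iff]
    intro e he
    have he' := hE.le he
    have hb : cb e = 0 := he'.1.1
    have hr : e.right = 1 := he'.1.2
    have hm : iota l false false * e * (iota l false false)⁻¹ * e = 1 := hE.minus e he
    obtain ⟨e1, -, e3, e4⟩ := conj_coords (iota l false false) e hr
    have ha := congrArg ca hm
    have hc := congrArg cc hm
    simp only [ca_mul, e1, e4, sgn_false, one_mul, ca_one] at ha
    simp only [cc_mul, e3, e4, sgn_false, one_mul, cc_one] at hc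
    exact ext_coords (by rw [eq_zero_of_add_self hl ha, ca_one]) (by rw [hb, cb_one])
      (by rw [eq_zero_of_add_self hl hc, cc_one]) (by rw [hr, SemidirectProduct.one_right])
  have hsup := hE.sup_eq
  rw [hE1, bot_sup_eq] at hsup
  have hx : (SemidirectProduct.inl (ofAdd ((1 : ZMod l), (0 : ZMod l), (0 : ZMod l))) : G l false false) ∈
      (signToy l false false hl).barTheta := by
    rw [hsup]
    exact ⟨⟨rfl, rfl⟩, mem_ker_one l false false _⟩
  exact one_ne_zero hx.2.1

/-- **THE SIGN TOY AT THE PRINTED PATTERN `(se, sθ) = (−, +)` is a `CoverDataAx`** (second, abelian,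
non-vacuity witness of the supplemented interface, after `HeisenbergWitness.heisenbergWitness`).
(toy; no claim about print) [cite: MochizukiEtTh2009, Prop 2.2(i) p.37] -/
@[reducible] def signToyAx : CoverDataAx.{0} l :=
  { toCoverData := signToy l true false hl
    pow_mem_barKer := signToy_pow_mem l true false hl
    inv_ell := signToy_inv_ell l true false hl rfl
    inv_theta := signToy_inv_theta l true false hl rfl }

/-- **Prop 2.2 (i) in the sign toys ⟺ the printed sign pattern**: for odd `l ≥ 3`,
`(signToy l se sθ).Prop22_i ↔ (se ∧ ¬ sθ)`. (`←`: L2-t2's discharged `CoverDataAx.prop22_i_holds`, BY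
NAME; `→`: the two countermodel computations above at `Π_C̲ = {b = 0} ⋊ ℤˣ`, `ι̲ = (0, −1)`.)
(toy; no claim about print) [cite: MochizukiEtTh2009, Prop 2.2(i) p.37] -/
theorem signToy_prop22_i_iff (h1 : 1 < l) :
    (signToy l se sθ hl).Prop22_i ↔ (se = true ∧ sθ = false) := by
  constructor
  · intro hP
    obtain ⟨E, hE, -⟩ := hP (PiCu l se sθ ⊓ PiX l se sθ) (PiCu l se sθ) (iota l se sθ)
      (isTypeLTorsPm_PiCu l se sθ hl) rfl (isInversion_iota l se sθ hl)
    cases sθ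
    · cases se
      · exact absurd hE (not_isMinusEigen_of_not_ell l false false hl rfl rfl h1 E)
      · exact ⟨rfl, rfl⟩
    · exact absurd hE (not_isMinusEigen_of_theta l se true hl rfl h1 _ E)
  · rintro ⟨rfl, rfl⟩
    exact (signToyAx l hl).prop22_i_holds

end SignToy

/-! ## 9. Headline corollaries over the bare interface `CoverData` -/

namespace CoverData

/-- **For EVERY odd `l ≥ 3`, the universal closure `∀ X : CoverData l, X.Prop22_i` is REFUTED** (the sign
toy with `ι̲` central violates Prop 2.2 (i)); the `∀ l`-closure was refuted first at `l = 3` by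
abc-iut-w6-d083's `CoverData.not_forall_prop22_i` (`Discharge/Sec2Prop22iRmk211BareNegative.lean`, same
phenomenon). Honest FACT-LIST reading of F-0596: a SCHEMA over `CoverData`, witnessed at `CoverDataAx`
instances (`CoverDataAx.prop22_i_holds`). (toy independence at the typed interface; no claim about print)
[cite: MochizukiEtTh2009, Prop 2.2(i) p.37] -/
theorem not_forall_prop22_i_of_odd {l : ℕ} (hl : Odd l) (h1 : 1 < l) :
    ¬ ∀ X : CoverData.{0} l, X.Prop22_i := fun h =>
  Bool.false_ne_true ((SignToy.signToy_prop22_i_iff l false false hl h1).mp (h _)).1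

/-- **`inv_theta` is NECESSARY for Prop 2.2 (i) at the interface**: a `CoverData l` (odd `l ≥ 3`) in
which `Δ̄_X` has exponent `l` and every element of `Δ_C ∖ Δ_X` acts by `−1` on `Δ̄^ell_X` (the axioms
`pow_mem_barKer`, `inv_ell` of `CoverDataAx`), yet `inv_theta` and Prop 2.2 (i) both fail — the sign toy
`(−, −)`, `ι̲` inverting everything. (toy independence; no claim about print: there `Δ_Θ = [Δ_X, Δ_X]`
forces `inv_theta` from `inv_ell`.) [cite: MochizukiEtTh2009, Prop 2.2(i) p.37] -/
theorem exists_inv_ell_not_prop22_i {l : ℕ} (hl : Odd l) (h1 : 1 < l) :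
    ∃ X : CoverData.{0} l,
      (∀ d ∈ X.PiX ⊓ X.aug.ker, d ^ l ∈ X.barKer) ∧
      (∀ c ∈ X.aug.ker, c ∉ X.PiX → ∀ d ∈ X.PiX ⊓ X.aug.ker, c * d * c⁻¹ * d ∈ X.barTheta) ∧
      ¬ (∀ c ∈ X.aug.ker, c ∉ X.PiX → ∀ t ∈ X.barTheta, c * t * c⁻¹ * t⁻¹ ∈ X.barKer) ∧
      ¬ X.Prop22_i :=
  ⟨SignToy.signToy l true true hl, SignToy.signToy_pow_mem l true true hl,
    SignToy.signToy_inv_ell l true true hl rfl, SignToy.signToy_not_inv_theta l true true hl rfl h1,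
    fun h => absurd ((SignToy.signToy_prop22_i_iff l true true hl h1).mp h).2 (by simp)⟩

/-- **`inv_ell` is NECESSARY for Prop 2.2 (i) at the interface**: a `CoverData l` (odd `l ≥ 3`) in which
`Δ̄_X` has exponent `l` and every element of `Δ_C ∖ Δ_X` acts by `+1` on `Δ̄_Θ` (the axioms
`pow_mem_barKer`, `inv_theta` of `CoverDataAx`), yet `inv_ell` and Prop 2.2 (i) both fail — the sign toy
`(+, +)`, `ι̲` central. (toy independence; no claim about print) [cite: MochizukiEtTh2009, Prop 2.2(i) p.37] -/
theorem exists_inv_theta_not_prop22_i {l : ℕ} (hl : Odd l) (h1 : 1 < l) :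
    ∃ X : CoverData.{0} l,
      (∀ d ∈ X.PiX ⊓ X.aug.ker, d ^ l ∈ X.barKer) ∧
      (∀ c ∈ X.aug.ker, c ∉ X.PiX → ∀ t ∈ X.barTheta, c * t * c⁻¹ * t⁻¹ ∈ X.barKer) ∧
      ¬ (∀ c ∈ X.aug.ker, c ∉ X.PiX → ∀ d ∈ X.PiX ⊓ X.aug.ker, c * d * c⁻¹ * d ∈ X.barTheta) ∧
      ¬ X.Prop22_i :=
  ⟨SignToy.signToy l false false hl, SignToy.signToy_pow_mem l false false hl,
    SignToy.signToy_inv_theta l false false hl rfl, SignToy.signToy_not_inv_ell l false false hl rfl h1,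
    fun h => Bool.false_ne_true ((SignToy.signToy_prop22_i_iff l false false hl h1).mp h).1⟩

end CoverData

end ThetaCovers

end Literature.AnabelianGeometry.EtaleTheta
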